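import Summits.QuantumFields.Balaban3D.Proofs.Thm2AC

/-!
# BalabanUVNodes ∕ N08 — THE RE-MASSED AC TOWER, I-a: NORMAL FORMS of a series AC tower's objects and the step leaves C1 `Bound55` ∕ C2 `Bound55Lower` of
# [Balaban1985UV3] ((22) p. 261, (55)·(58) pp. 269–270, p. 272 L32–33) at the PINNED pieces of ANY series AC base (the lane's abstract step, re-packaged)

Track A, DAG node N08 = T. Bałaban, CMP **102** (1985) 255–275 [Balaban1985UV3]: (41) p. 266, (48)–(49) pp. 267–268, (55) p. 269, (58) p. 270, p. 272 L32–33; the averaging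
(2) = [Balaban1985Averaging] (15) p. 19.  Cell `pub-ymgap`, width seat `pub-ymgap-dag-n08-w1` (g4), W-SEAT-START-LIST §n08 item 1 successor piece (o13a) = file 19a;
`--supports` K1⁷ `StabilityBAtRecordR13SepCoPH` (helper).  First of the «RE-MASSED AC TOWER» files (part (b) of `N08-E6PRIME-LOAD-POINT.md` built Summits-side:
a series AC tower over the SAME external inputs, expansion data and parameters with the mass carrier replaced by one agreeing `dU`-a.e. with print's `massRecAC`;
companion I-b `…N08ReMassedACStepBounds` instantiates this file at the re-massed base).

THE DEVICE (located).  Comparing a tower-level object (main term, `χ`, `E_k`, remainders, `Z`-terms, functional, interaction sum) of the std AC tower with the SAME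
object of a re-massed tower DEFINITIONALLY is hopeless in practice (same head symbols, different 21-field structure arguments: the unifier compares the structures field
by field at every nesting level — measured: `whnf`/`isDefEq` time-outs at 200 000 heartbeats).  Comparing either with its NORMAL FORM at the base (`(1/g_k²)A^η(B.UkH k h U)`,
`chiSmall univ (B.ε₁ k)`, `B10.Ek (estepOfSeries 𝔖 C) K k`, the explicit sums, `LFAC B.W`, `pintOfSeries B.M₁ B.Rcol 𝔖`) is one-sided and cheap — `rfl` (§1).  So every
transfer in this series goes: tower term ↦ normal form (both sides) ↦ compare at the base.

WHAT THIS FILE PROVES (kernel; theorems only, 0 def; [folklore] bookkeeping over the lane's DEFINED objects; nothing of the paper asserted).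
* §1 NORMAL FORMS (`rfl`): `towerWith_mainT∕_chi∕_Ecst∕_Rm∕_Zterm∕_LF`, `withSeriesAC_Pint∕_av∕_W∕_UkH` (any series base `B`, any slot), `tower3_Pint∕_LF∕_mainT∕_Zterm∕_Λvol∕
  _g∕_sites∕_K∕_M₁∕_b₀∕_p₀` (any `TowerInputAC`).
* §2 ★★ `bound55_seriesPiecesAC` ∕ `bound55Lower_seriesPiecesAC` — C1∕C2 at the pinned pieces `B.seriesPiecesAC 𝔖 C k` of ANY series AC base `B` from the lane's
  `Bound55AC.bound55_of_select` ∕ `bound55Lower_of_select` (selection `run3_rho_succ_le_upper` ∕ `run3_lower_le_rho_succ`, barrier pinnings `rfl`, `pin_rho`), given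
  `hm₁`, masses vanishing off admissible histories, the floor `1 ≤ m(triv)`, `Rm ≥ 0`, the integrability `hint`∕`hint47` and the two fibre displays (hypotheses);
  `hint_seriesAC` ∕ `hint47_seriesAC` (copies of `Bound55AC.hint_stdAC`∕`hint47_stdAC` for a generic base) and `rm_nonneg_seriesAC`.

HONEST FRAMING: count-neutral helper; the fibre displays and `hm₁` are HYPOTHESES here; N08 NOT discharged; one finite 𝕋⁴ programme at fixed ε, Bałaban AS PRINTED — R4
closes the conditional finite-𝕋⁴ rung `BalabanLadder.UV` only; the Yang–Mills mass gap (Clay) is NOT proved by any of this; nothing continuum ∕ ℝ⁴ ∕ OS.  No `sorry`,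
standard axioms.
-/

noncomputable section

open MeasureTheory

namespace Summit.QuantumFields.YangMills.BalabanUVNodes.N08SeriesACStepBounds

open Literature.MathematicalPhysics.QuantumFieldTheory.Balaban1983to89
open Literature.MathematicalPhysics.QuantumFieldTheory.Balaban1983to89.AveragingRT (rnTransport rnTransport_nonneg)
open Literature.MathematicalPhysics.QuantumFieldTheory.Balaban1983to89.B10 (TowerRun pFun)
open Literature.MathematicalPhysics.QuantumFieldTheory.Balaban1983to89.B10SectAGathering (StepPieces Bound55 Bound55Lower)
open Literature.MathematicalPhysics.QuantumFieldTheory.Balaban1985CMP102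
open Literature.MathematicalPhysics.QuantumFieldTheory.Balaban1985CMP102.Setting
open Literature.MathematicalPhysics.QuantumFieldTheory.Balaban1985CMP102.SectB (TowerObjects)
open Summit.QuantumFields.Balaban3D
open Summit.QuantumFields.Balaban3D.Carriers
open Summit.QuantumFields.Balaban3D.Proofs
open Summit.QuantumFields.Balaban3D.Proofs.TowerAC
open Summit.QuantumFields.Balaban3D.Proofs.SeriesAC
open Summit.QuantumFields.Balaban3D.Proofs.StandardAC
open Summit.QuantumFields.Balaban3D.Proofs.InputsAC
open Summit.QuantumFields.Balaban3D.Proofs.MassesAC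
open Summit.QuantumFields.Balaban3D.Proofs.Bound55AC
open Summit.QuantumFields.Balaban3D.Proofs.Bound55Masses (chiB chiB_nonneg chiB_le_one measurable_chiB measurable_stepWeight stepWeight_mul_chiB_cover)
open Summit.QuantumFields.Balaban3D.Proofs.AlphaAC (AlphaDataAC StepAlphaAC)
open Summit.QuantumFields.Balaban3D.Proofs.GroupModelLieC (lieC)

variable {L : ℕ} {S : Scales L} {G : Type} [GaugeGroup G] [MeasurableSpace G] [HaarData G]

/-! ## §1 Normal forms of the series AC tower's objects (all `rfl`) -/
section NormalForms

variable {V : Type} [NormedAddCommGroup V] [NormedSpace ℂ V] {Nc : ℕ → ℕ} [∀ k, NeZero (Nc k)]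
  (B : TowerBaseAC S G) (𝔖 : ∀ k, StepSeries S G V (Nc k) k) (C : ∀ k, PiecesParams S k) (slot : ℕ → Prop)

/-- Main term of the series AC tower: `(1/g_k²)A^η(U_k(V,h))` at the base's composite minimiser. [cite: Balaban1985UV3, (41)–(42) p.266 (bookkeeping)] -/
theorem towerWith_mainT (k : ℕ) (h : Hist S.P k) (U : GaugeField S.P k G) :
    ((B.withSeriesAC 𝔖 C).towerWith slot).mainT k h U = (S.gk k)⁻¹ ^ 2 * S.actionEta k (B.UkH k h U) := rfl

/-- `χ_k` of the series AC tower: the (4) characteristic function at the base's `ε₁`. [cite: Balaban1985UV3, (4) p.256 (bookkeeping)] -/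
theorem towerWith_chi (k : ℕ) (U : GaugeField S.P k G) : ((B.withSeriesAC 𝔖 C).towerWith slot).chi k U = chiSmall Set.univ (B.ε₁ k) U := rfl

/-- `E_k` of the series AC tower ((64)). [cite: Balaban1985UV3, (64) p.273 (bookkeeping)] -/
theorem towerWith_Ecst (k : ℕ) : ((B.withSeriesAC 𝔖 C).towerWith slot).Ecst k = B10.Ek (estepOfSeries 𝔖 C) S.K k := rfl

/-- Remainder sum of the series AC tower. [cite: Balaban1985UV3, (41) p.266 (bookkeeping)] -/
theorem towerWith_Rm (k : ℕ) :
    ((B.withSeriesAC 𝔖 C).towerWith slot).Rm k = ∑ j ∈ Finset.range k, B.rcoef j * ((L : ℝ) ^ j * S.ε) ^ (3 + B.κ₀) * S.sites j := rfl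

/-- `Z`-terms of the series AC tower. [cite: Balaban1985UV3, (41) p.266 (bookkeeping)] -/
theorem towerWith_Zterm (k : ℕ) (h : Hist S.P k) :
    ((B.withSeriesAC 𝔖 C).towerWith slot).Zterm k h = ∑ j ∈ Finset.range k, B.zcoef j * (ZVol B.M₁ B.Rcol k h j : ℝ) := rfl

/-- Functional of the series AC tower: `LFAC` of the base's masses. [cite: Balaban1985UV3, (41) p.266 (bookkeeping)] -/
theorem towerWith_LF (k : ℕ) (U : GaugeField S.P k G) (F : Hist S.P k → ℝ) : ((B.withSeriesAC 𝔖 C).towerWith slot).LF k U F = LFAC B.W k U F := rfl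

/-- The interaction sum of the series AC input is `pintOfSeries`. [folklore] -/
theorem withSeriesAC_Pint : (B.withSeriesAC 𝔖 C).Pint = pintOfSeries B.M₁ B.Rcol 𝔖 := rfl

/-- The series AC input's averaging ∕ masses ∕ composite minimisers are the base's. [folklore] -/
theorem withSeriesAC_av : (B.withSeriesAC 𝔖 C).av = B.av := rfl

/-- see `withSeriesAC_av`. [folklore] -/
theorem withSeriesAC_W : (B.withSeriesAC 𝔖 C).W = B.W := rfl

/-- see `withSeriesAC_av`. [folklore] -/
theorem withSeriesAC_UkH : (B.withSeriesAC 𝔖 C).UkH = B.UkH := rfl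

/-- The series AC input's scalar parameters are the base's. [folklore] -/
theorem withSeriesAC_M₁ : (B.withSeriesAC 𝔖 C).M₁ = B.M₁ := rfl

/-- see `withSeriesAC_M₁`. [folklore] -/
theorem withSeriesAC_Rcol : (B.withSeriesAC 𝔖 C).Rcol = B.Rcol := rfl

/-- see `withSeriesAC_M₁`. [folklore] -/
theorem withSeriesAC_b₀ : (B.withSeriesAC 𝔖 C).b₀ = B.b₀ := rfl

/-- see `withSeriesAC_M₁`. [folklore] -/
theorem withSeriesAC_p₀ : (B.withSeriesAC 𝔖 C).p₀ = B.p₀ := rfl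

/-- see `withSeriesAC_M₁`. [folklore] -/
theorem withSeriesAC_κ₀ : (B.withSeriesAC 𝔖 C).κ₀ = B.κ₀ := rfl

/-- see `withSeriesAC_M₁`. [folklore] -/
theorem withSeriesAC_ε₁ : (B.withSeriesAC 𝔖 C).ε₁ = B.ε₁ := rfl

/-- see `withSeriesAC_M₁`. [folklore] -/
theorem withSeriesAC_rcoef : (B.withSeriesAC 𝔖 C).rcoef = B.rcoef := rfl

/-- see `withSeriesAC_M₁`. [folklore] -/
theorem withSeriesAC_zcoef : (B.withSeriesAC 𝔖 C).zcoef = B.zcoef := rfl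

/-- see `withSeriesAC_M₁`. [folklore] -/
theorem withSeriesAC_Estep : (B.withSeriesAC 𝔖 C).Estep = estepOfSeries 𝔖 C := rfl

/-- The pinned pieces' analytic fields are the series' `StepData` at the base's `M₁`, `Rcol`, `Rret`; the counts∕constants are the parameters'. [folklore] -/
theorem seriesPiecesAC_logZU (k : ℕ) : (B.seriesPiecesAC 𝔖 C k).logZU = ((𝔖 k).toStepData B.M₁ B.Rcol (B.Rret k)).logZU := rfl

/-- see `seriesPiecesAC_logZU`. [folklore] -/
theorem seriesPiecesAC_logZ1 (k : ℕ) : (B.seriesPiecesAC 𝔖 C k).logZ1 = ((𝔖 k).toStepData B.M₁ B.Rcol (B.Rret k)).logZ1 := rfl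

/-- see `seriesPiecesAC_logZU`. [folklore] -/
theorem seriesPiecesAC_logZT (k : ℕ) : (B.seriesPiecesAC 𝔖 C k).logZT = ((𝔖 k).toStepData B.M₁ B.Rcol (B.Rret k)).logZT := rfl

/-- see `seriesPiecesAC_logZU`. [folklore] -/
theorem seriesPiecesAC_PprT (k : ℕ) : (B.seriesPiecesAC 𝔖 C k).PprT = ((𝔖 k).toStepData B.M₁ B.Rcol (B.Rret k)).PprT := rfl

/-- see `seriesPiecesAC_logZU`. [folklore] -/
theorem seriesPiecesAC_logσ₀ (k : ℕ) : (B.seriesPiecesAC 𝔖 C k).logσ₀ = (C k).logσ₀ := rfl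

/-- see `seriesPiecesAC_logZU`. [folklore] -/
theorem seriesPiecesAC_dg (k : ℕ) : (B.seriesPiecesAC 𝔖 C k).dg = (C k).dg := rfl

/-- see `seriesPiecesAC_logZU`. [folklore] -/
theorem seriesPiecesAC_starT (k : ℕ) : (B.seriesPiecesAC 𝔖 C k).starT = (C k).starT := rfl

/-- see `seriesPiecesAC_logZU`. [folklore] -/
theorem seriesPiecesAC_rem (k : ℕ) : (B.seriesPiecesAC 𝔖 C k).rem = (C k).rem := rfl

variable (D : TowerInputAC S G)

/-- The pinned tower's interaction sum is the input's. [folklore] -/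
theorem tower3_Pint (k : ℕ) (h : Hist S.P k) (U : GaugeField S.P k G) : D.tower3.toTowerRun.Pint k h U = D.Pint k h U := rfl

/-- The pinned tower's functional is `LFAC` of the input's masses. [folklore] -/
theorem tower3_LF (k : ℕ) (U : GaugeField S.P k G) (F : Hist S.P k → ℝ) : D.tower3.toTowerRun.LF k U F = LFAC D.W k U F := rfl

/-- The pinned tower's main term. [folklore] -/
theorem tower3_mainT (k : ℕ) (h : Hist S.P k) (U : GaugeField S.P k G) :
    D.tower3.toTowerRun.mainT k h U = (S.gk k)⁻¹ ^ 2 * S.actionEta k (D.UkH k h U) := rfl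

/-- The pinned tower's `Z`-terms. [folklore] -/
theorem tower3_Zterm (k : ℕ) (h : Hist S.P k) :
    D.tower3.toTowerRun.Zterm k h = ∑ j ∈ Finset.range k, D.zcoef j * (ZVol D.M₁ D.Rcol k h j : ℝ) := rfl

/-- The pinned tower's `|Λ_k|` (R-LAMVOL). [folklore] -/
theorem tower3_Λvol (k : ℕ) (h : Hist S.P k) : D.tower3.toTowerRun.Λvol k h = min (LamVol D.M₁ D.Rcol k h : ℝ) (S.sites k) := rfl

/-- The pinned tower's running coupling ∕ site count ∕ number of steps ∕ parameters. [folklore] -/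
theorem tower3_g (k : ℕ) : D.tower3.toTowerRun.g k = S.gk k := rfl

/-- see `tower3_g`. [folklore] -/
theorem tower3_sites (k : ℕ) : D.tower3.toTowerRun.sites k = S.sites k := rfl

/-- see `tower3_g`. [folklore] -/
theorem tower3_K : D.tower3.toTowerRun.K = S.K := rfl

/-- see `tower3_g`. [folklore] -/
theorem tower3_M₁ : D.tower3.toTowerRun.M₁ = (D.M₁ : ℝ) := rfl

/-- see `tower3_g`. [folklore] -/
theorem tower3_b₀ : D.tower3.toTowerRun.b₀ = D.b₀ := rfl

/-- see `tower3_g`. [folklore] -/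
theorem tower3_p₀ : D.tower3.toTowerRun.p₀ = D.p₀ := rfl

end NormalForms

/-! ## §2 C1 ∕ C2 at the pinned pieces of ANY series AC base from the lane's abstract step -/
section Generic

variable [RegularGaugeGroup G] {V : Type} [NormedAddCommGroup V] [NormedSpace ℂ V] {Nc : ℕ → ℕ} [∀ k, NeZero (Nc k)]
  (B : TowerBaseAC S G) (𝔖 : ∀ k, StepSeries S G V (Nc k) k) (C : ∀ k, PiecesParams S k) (εL εS : ℕ → ℝ) (k : ℕ)

/-- ★★ **C1 `Bound55` AT THE PINNED PIECES OF ANY SERIES AC BASE** — the lane's `Bound55AC.bound55_of_select` at the base's own tower (barriers pinned by `rfl`,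
selection `run3_rho_succ_le_upper` with `lower ≤ upper` from the floor `m(triv) ≥ 1`), transported from the unpinned to the pinned pieces (`pin_rho`).  Hypotheses: the
decomposition thresholds `εL k ≤ εS k`; `hm₁` «transport of the weighted mass ≤ next mass, a.e.»; masses vanish off admissible histories; `1 ≤ m_{k+1}(triv)`; `Rm_k ≥ 0`;
integrability of the (41)_k summands; the fibre inequality R3D-01 per new history (a (β) ρ-display, hypothesis). [cite: Balaban1985UV3, (22) p.261 + (48)–(49) pp.267–268 + (55) p.269 + (58) p.270] -/
theorem bound55_seriesPiecesAC (hLS : εL k ≤ εS k)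
    (hm₁ : ∀ h' : Hist S.P (k + 1), (rnTransport (B.av k).avg fun U => stepWeight B.M₁ B.Rcol εL εS k h' U * B.W.mass k h'.proj U)
      ≤ᵐ[fieldMeasure S.P (k + 1) G] B.W.mass (k + 1) h')
    (hWadm : ∀ (h : Hist S.P k) (U : GaugeField S.P k G), ¬ Hist.Admissible B.M₁ B.Rcol k h → B.W.mass k h U = 0)
    (hmt : ∀ V : GaugeField S.P (k + 1) G, 1 ≤ B.W.mass (k + 1) (Hist.triv S.P (k + 1)) V)
    (hRm : 0 ≤ ((B.withSeriesAC 𝔖 C).towerWith fun _ => True).Rm k)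
    (hint : ∀ h : Hist S.P k, Integrable (fun U => B.W.mass k h U *
      Real.exp (-(((B.withSeriesAC 𝔖 C).towerWith fun _ => True).mainT k h U) + (B.withSeriesAC 𝔖 C).Pint k h U
        - ((B.withSeriesAC 𝔖 C).towerWith fun _ => True).Ecst k
        + ((B.withSeriesAC 𝔖 C).towerWith fun _ => True).Zterm k h + ((B.withSeriesAC 𝔖 C).towerWith fun _ => True).Rm k)) (fieldMeasure S.P k G))
    (hfibre : ∀ h' : Hist S.P (k + 1),
      (rnTransport (B.av k).avg (fun U => stepWeight B.M₁ B.Rcol εL εS k h' U * chiB B.M₁ B.Rcol εL k h' U * (B.W.mass k h'.proj U *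
        Real.exp (-(((B.withSeriesAC 𝔖 C).towerWith fun _ => True).mainT k h'.proj U) + (B.withSeriesAC 𝔖 C).Pint k h'.proj U
          - ((B.withSeriesAC 𝔖 C).towerWith fun _ => True).Ecst k
          + ((B.withSeriesAC 𝔖 C).towerWith fun _ => True).Zterm k h'.proj + ((B.withSeriesAC 𝔖 C).towerWith fun _ => True).Rm k))))
      ≤ᵐ[fieldMeasure S.P (k + 1) G] fun V => rnTransport (B.av k).avg (fun U => stepWeight B.M₁ B.Rcol εL εS k h' U * B.W.mass k h'.proj U) V *
        Real.exp (-(((B.withSeriesAC 𝔖 C).towerWith fun _ => True).mainT (k + 1) h' V) - ((B.withSeriesAC 𝔖 C).towerWith fun _ => True).Ecst k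
          + ((C k).logσ₀ + (C k).dg * Real.log (S.gk k)) * (C k).starB h' + (𝔖 k).logZU h' V + (𝔖 k).Pold B.M₁ B.Rcol h' V
          + ((B.withSeriesAC 𝔖 C).towerWith fun _ => True).Zterm k (Hist.proj h') + ((B.withSeriesAC 𝔖 C).towerWith fun _ => True).Rm k
          + (𝔖 k).logFl h' V)) :
    Bound55 (B.seriesPiecesAC 𝔖 C k) := by
  -- the unpinned pieces with the same fields
  let D : TowerInputAC S G := B.withSeriesAC 𝔖 C
  let Q := B.seriesPiecesAC 𝔖 C k
  let P' : StepPieces (D.towerWith fun _ => True).toTowerRun k :=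
    { proj := Q.proj, proj_triv := Q.proj_triv, Zvol := Q.Zvol, Zvol_nonneg := Q.Zvol_nonneg, Zvol_triv := Q.Zvol_triv,
      starB := Q.starB, starT := Q.starT, logσ₀ := Q.logσ₀, dg := Q.dg, dg_nonneg := Q.dg_nonneg, logZU := Q.logZU, logZ1 := Q.logZ1,
      logZT := Q.logZT, logFl := Q.logFl, PprU := Q.PprU, Ppr1 := Q.Ppr1, PprT := Q.PprT, PY := Q.PY, PYZ := Q.PYZ, Pold := Q.Pold,
      PoldIn := Q.PoldIn, rem := Q.rem, rem_nonneg := Q.rem_nonneg }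
  have hcover : ∀ (h : Hist S.P k) (U : GaugeField S.P k G), D.W.mass k h U ≠ 0 →
      ∃ h' : Hist S.P (k + 1), h'.proj = h ∧ (1 : ℝ) ≤ stepWeight B.M₁ B.Rcol εL εS k h' U * chiB B.M₁ B.Rcol εL k h' U := by
    intro h U hm
    have hh : Hist.Admissible B.M₁ B.Rcol k h := by
      by_contra hna
      exact hm (hWadm h U hna)
    exact ⟨_, stepWeight_mul_chiB_cover B.M₁ B.Rcol εL εS k hLS h hh U⟩
  have hlu : ∀ W, D.lower k W ≤ D.upper k W := fun W => by
    rw [B.withSeriesAC_lower 𝔖 C (fun _ => True) k W, B.withSeriesAC_upper 𝔖 C (fun _ => True) k W]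
    exact lower57_le_upper55_of_one_le D (fun _ => True) k P' hmt hRm W
  have hW : Bound55 P' :=
    bound55_of_select D (fun _ => True) k P' (B.avgAC k)
      (stepWeight B.M₁ B.Rcol εL εS k) (chiB B.M₁ B.Rcol εL k)
      (measurable_stepWeight B.M₁ B.Rcol εL εS k) (stepWeight_nonneg B.M₁ B.Rcol εL εS k) (stepWeight_le_one B.M₁ B.Rcol εL εS k)
      (measurable_chiB B.M₁ B.Rcol εL k) (chiB_nonneg B.M₁ B.Rcol εL k) (chiB_le_one B.M₁ B.Rcol εL k)
      hcover hm₁ hint hfibre (fun W => B.withSeriesAC_upper 𝔖 C (fun _ => True) k W)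
      (fun hae W => run3_rho_succ_le_upper (D.toRunInput fun _ => True) k hae hlu W)
  -- pin transfer
  intro h41 U
  have hb := hW (((D.towerWith fun _ => True).ineq41_pin_iff k).mp h41) U
  have hρ : D.tower3.toTowerRun.ρ (k + 1) U = (D.towerWith fun _ => True).toTowerRun.ρ (k + 1) U :=
    congrFun ((D.towerWith fun _ => True).pin_rho (k + 1)) U
  show D.tower3.toTowerRun.ρ (k + 1) U ≤ _
  rw [hρ]
  exact hb

/-- ★★ **C2 `Bound55Lower` AT THE PINNED PIECES OF ANY SERIES AC BASE** — the lane's `bound55Lower_of_select` (selection `run3_lower_le_rho_succ`, lower barrier by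
`rfl`), transported to the pinned pieces; hypotheses: integrability of the (47)_k left-hand side and the trivial-history fibre inequality R3D-02 (a (β) ρ-display,
hypothesis). [cite: Balaban1985UV3, p.265 L21–28 + (47) p.267 + p.272 L32–33] -/
theorem bound55Lower_seriesPiecesAC
    (hint47 : Integrable (fun U => ((B.withSeriesAC 𝔖 C).towerWith fun _ => True).chi k U *
      Real.exp (-(((B.withSeriesAC 𝔖 C).towerWith fun _ => True).mainT k (Hist.triv S.P k) U) + (B.withSeriesAC 𝔖 C).Pint k (Hist.triv S.P k) U
        - ((B.withSeriesAC 𝔖 C).towerWith fun _ => True).Ecst k - ((B.withSeriesAC 𝔖 C).towerWith fun _ => True).Rm k)) (fieldMeasure S.P k G))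
    (hfibreLow : (fun V => ((B.withSeriesAC 𝔖 C).towerWith fun _ => True).chi (k + 1) V *
        Real.exp (-(((B.withSeriesAC 𝔖 C).towerWith fun _ => True).mainT (k + 1) (Hist.triv S.P (k + 1)) V)
          - ((B.withSeriesAC 𝔖 C).towerWith fun _ => True).Ecst k
          + ((C k).logσ₀ + (C k).dg * Real.log (S.gk k)) * (C k).starB (Hist.triv S.P (k + 1)) + (𝔖 k).logZU (Hist.triv S.P (k + 1)) V
          + (𝔖 k).Pold B.M₁ B.Rcol (Hist.triv S.P (k + 1)) V - ((B.withSeriesAC 𝔖 C).towerWith fun _ => True).Rm k + (𝔖 k).logFl (Hist.triv S.P (k + 1)) V))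
      ≤ᵐ[fieldMeasure S.P (k + 1) G] rnTransport (B.av k).avg (fun U => ((B.withSeriesAC 𝔖 C).towerWith fun _ => True).chi k U *
        Real.exp (-(((B.withSeriesAC 𝔖 C).towerWith fun _ => True).mainT k (Hist.triv S.P k) U) + (B.withSeriesAC 𝔖 C).Pint k (Hist.triv S.P k) U
          - ((B.withSeriesAC 𝔖 C).towerWith fun _ => True).Ecst k - ((B.withSeriesAC 𝔖 C).towerWith fun _ => True).Rm k))) :
    Bound55Lower (B.seriesPiecesAC 𝔖 C k) := by
  let D : TowerInputAC S G := B.withSeriesAC 𝔖 C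
  let Q := B.seriesPiecesAC 𝔖 C k
  let P' : StepPieces (D.towerWith fun _ => True).toTowerRun k :=
    { proj := Q.proj, proj_triv := Q.proj_triv, Zvol := Q.Zvol, Zvol_nonneg := Q.Zvol_nonneg, Zvol_triv := Q.Zvol_triv,
      starB := Q.starB, starT := Q.starT, logσ₀ := Q.logσ₀, dg := Q.dg, dg_nonneg := Q.dg_nonneg, logZU := Q.logZU, logZ1 := Q.logZ1,
      logZT := Q.logZT, logFl := Q.logFl, PprU := Q.PprU, Ppr1 := Q.Ppr1, PprT := Q.PprT, PY := Q.PY, PYZ := Q.PYZ, Pold := Q.Pold,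
      PoldIn := Q.PoldIn, rem := Q.rem, rem_nonneg := Q.rem_nonneg }
  have hW : Bound55Lower P' :=
    bound55Lower_of_select D (fun _ => True) k P' (B.avgAC k) hint47 hfibreLow (fun W => B.withSeriesAC_lower 𝔖 C (fun _ => True) k W)
      (fun hae W => run3_lower_le_rho_succ (D.toRunInput fun _ => True) k hae W)
  intro h47 U
  have hb := hW (((D.towerWith fun _ => True).ineq47_pin_iff k).mp h47) U
  have hρ : D.tower3.toTowerRun.ρ (k + 1) U = (D.towerWith fun _ => True).toTowerRun.ρ (k + 1) U :=
    congrFun ((D.towerWith fun _ => True).pin_rho (k + 1)) U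
  show _ ≤ D.tower3.toTowerRun.ρ (k + 1) U
  rw [hρ]
  exact hb

/-- **`hint` for ANY series AC base**: the (41)_k summand `m_k(h)·exp[−(1/g_k²)A^η(U_k(·,h)) + Σ𝒫 − E_k + Z-terms + remainders]` is integrable once the composite
minimiser map is measurable, the interaction sum is measurable and bounded above, and the mass is integrable (`TransportAC.integrable_mul_exp_of_le`; copy of
`Bound55AC.hint_stdAC` for a generic base). [folklore] -/
theorem hint_seriesAC (hU : ∀ h : Hist S.P k, Measurable (B.UkH k h))
    (hPm : ∀ h : Hist S.P k, Measurable ((B.withSeriesAC 𝔖 C).Pint k h)) (cP : ℝ)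
    (hPb : ∀ (h : Hist S.P k) (U : GaugeField S.P k G), (B.withSeriesAC 𝔖 C).Pint k h U ≤ cP)
    (hWi : ∀ h : Hist S.P k, Integrable (B.W.mass k h) (fieldMeasure S.P k G)) (h : Hist S.P k) :
    Integrable (fun U => B.W.mass k h U *
      Real.exp (-(((B.withSeriesAC 𝔖 C).towerWith fun _ => True).mainT k h U) + (B.withSeriesAC 𝔖 C).Pint k h U
        - ((B.withSeriesAC 𝔖 C).towerWith fun _ => True).Ecst k
        + ((B.withSeriesAC 𝔖 C).towerWith fun _ => True).Zterm k h + ((B.withSeriesAC 𝔖 C).towerWith fun _ => True).Rm k)) (fieldMeasure S.P k G) := by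
  have hmain : ∀ U, ((B.withSeriesAC 𝔖 C).towerWith fun _ => True).mainT k h U = (S.gk k)⁻¹ ^ 2 * S.actionEta k (B.UkH k h U) := fun _ => rfl
  refine TransportAC.integrable_mul_exp_of_le (hWi h) ?_
    (c := cP - ((B.withSeriesAC 𝔖 C).towerWith fun _ => True).Ecst k
      + ((B.withSeriesAC 𝔖 C).towerWith fun _ => True).Zterm k h + ((B.withSeriesAC 𝔖 C).towerWith fun _ => True).Rm k) ?_
  · simp_rw [hmain]
    exact ((((measurable_const.mul ((Bound55Std.measurable_actionEta (S := S) k).comp (hU h))).neg.add (hPm h)).sub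
      measurable_const).add measurable_const).add measurable_const
  · intro U
    have h0 : 0 ≤ ((B.withSeriesAC 𝔖 C).towerWith fun _ => True).mainT k h U := by
      rw [hmain]; exact mul_nonneg (sq_nonneg _) (Bound55Std.actionEta_nonneg (S := S) k _)
    have h1 := hPb h U
    linarith

/-- **`hint47` for ANY series AC base** (the (47)_k left-hand side; `χ_k ∈ [0,1]` measurable; copy of `Bound55AC.hint47_stdAC`). [folklore] -/
theorem hint47_seriesAC (hU : Measurable (B.UkH k (Hist.triv S.P k)))
    (hPm : Measurable ((B.withSeriesAC 𝔖 C).Pint k (Hist.triv S.P k))) (cP : ℝ)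
    (hPb : ∀ U : GaugeField S.P k G, (B.withSeriesAC 𝔖 C).Pint k (Hist.triv S.P k) U ≤ cP) :
    Integrable (fun U => ((B.withSeriesAC 𝔖 C).towerWith fun _ => True).chi k U *
      Real.exp (-(((B.withSeriesAC 𝔖 C).towerWith fun _ => True).mainT k (Hist.triv S.P k) U)
        + (B.withSeriesAC 𝔖 C).Pint k (Hist.triv S.P k) U
        - ((B.withSeriesAC 𝔖 C).towerWith fun _ => True).Ecst k - ((B.withSeriesAC 𝔖 C).towerWith fun _ => True).Rm k)) (fieldMeasure S.P k G) := by
  have hmain : ∀ U, ((B.withSeriesAC 𝔖 C).towerWith fun _ => True).mainT k (Hist.triv S.P k) U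
      = (S.gk k)⁻¹ ^ 2 * S.actionEta k (B.UkH k (Hist.triv S.P k) U) := fun _ => rfl
  have hchi : ((B.withSeriesAC 𝔖 C).towerWith fun _ => True).chi k = chiSmall Set.univ (B.ε₁ k) := rfl
  refine Transport48.integrable_weight_mul_exp ?_ ?_ ?_ ?_
    (c := cP - ((B.withSeriesAC 𝔖 C).towerWith fun _ => True).Ecst k - ((B.withSeriesAC 𝔖 C).towerWith fun _ => True).Rm k) ?_
  · rw [hchi]; exact T4AxialGaugeFixing.measurable_chiSmall _ _
  · intro U; rw [hchi]; unfold chiSmall; split_ifs <;> norm_num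
  · intro U; rw [hchi]; unfold chiSmall; split_ifs <;> norm_num
  · simp_rw [hmain]
    exact (((measurable_const.mul ((Bound55Std.measurable_actionEta (S := S) k).comp hU)).neg.add hPm).sub measurable_const).sub
      measurable_const
  · intro U
    have h0 : 0 ≤ ((B.withSeriesAC 𝔖 C).towerWith fun _ => True).mainT k (Hist.triv S.P k) U := by
      rw [hmain]; exact mul_nonneg (sq_nonneg _) (Bound55Std.actionEta_nonneg (S := S) k _)
    have h1 := hPb U
    linarith

omit [RegularGaugeGroup G] in
/-- `Rm_k ≥ 0` for a series AC base with non-negative remainder coefficients. [folklore] -/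
theorem rm_nonneg_seriesAC (hr : ∀ j, 0 ≤ B.rcoef j) : 0 ≤ ((B.withSeriesAC 𝔖 C).towerWith fun _ => True).Rm k := by
  rw [towerWith_Rm]
  refine Finset.sum_nonneg fun j _ => ?_
  exact mul_nonneg (mul_nonneg (hr j) (Real.rpow_nonneg (ScalesArithmetic.pow_mul_eps_pos S j).le _)) (ScalesArithmetic.sites_nonneg S j)

end Generic

end Summit.QuantumFields.YangMills.BalabanUVNodes.N08SeriesACStepBounds

end
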